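import Literature.NumberTheory.LFunctions.WeilFirstPrimeOddMarginDataC
import HarnessLib

/-!
# Odd-sector margin certificate C: the value of `κ` and the scalar side conditions

Part of the check of `weilCertOddC` (`WeilFirstPrimeOddMarginDataC.lean`), by `decide +kernel` (one evaluation of `kappaExact`: `cellsAbsMomentQ` at `N+1 = 100` and `cellsBndMaxQ`). Pure proof file; nothing is asserted.
-/

noncomputable section

namespace Literature.NumberTheory.LFunctions

set_option maxHeartbeats 0 in
/-- **The value of `κ`** of the odd-sector margin certificate C. [folklore] -/
theorem kappaQ_weilCertOddC : weilCertOddC.kappaQ = (372225048789708063924786319655423210745/340282366920938463463374607431768211456 : ℚ) := by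
  decide +kernel

/-- The margin is positive and below `κ`: `0 ≤ κ' ≤ κ` for certificate C (`κ − κ' = 22444110741115277833740043261867257/340282366920938463463374607431768211456 ≈ 6.5957e-05`). [folklore] -/
theorem kappa'_nonneg_le_weilCertOddC : 0 ≤ weilCertOddCKappa' ∧ weilCertOddCKappa' ≤ weilCertOddC.kappaQ := by
  rw [kappaQ_weilCertOddC]; unfold weilCertOddCKappa'; norm_num

set_option maxHeartbeats 0 in
/-- **Kernel check of the scalar side conditions** of certificate C (`0 < b ≤ a₀ ≤ 1`, `2a₀T ≤ N+2`, Taylor remainder, `κ ≥ 0`), with `κ` rewritten to its value first. [folklore] -/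
theorem checkScalars_weilCertOddC : weilCertOddC.checkScalars = true := by
  have h : weilCertOddC.checkScalars = (decide (1 ≤ weilCertOddC.j) && decide (0 < weilCertOddC.b) && decide (weilCertOddC.b ≤ weilCertOddC.base.a0) &&
      decide (weilCertOddC.base.a0 ≤ 1) && decide (0 < weilCertOddC.base.T) && decide (2 * weilCertOddC.base.a0 * weilCertOddC.base.T ≤ (weilCertOddC.base.N : ℚ) + 2) &&
      decide (2 * (weilCertOddC.base.a0 * weilCertOddC.base.T) ^ (weilCertOddC.base.N + 1) / (weilCertOddC.base.N + 1).factorial ≤ 1) &&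
      decide (weilCertOddC.base.N + 1 = 2 * weilCertOddC.base.nb) && decide (0 ≤ weilCertOddC.kappaQ)) := rfl
  rw [h, kappaQ_weilCertOddC]
  decide +kernel

end Literature.NumberTheory.LFunctions
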